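import Mathlib
import Literature.NumberTheory.LFunctions.SiegelWalfiszLiouville
import Literature.NumberTheory.LFunctions.SiegelWalfiszMoebiusProofs
import HarnessLib

/-!
# `LiouvilleOrthogonalTC0` (stmt-QuantumAdvantage-1393) — line `Sketch`, stub `stub_periodic`

The Liouville function is orthogonal to every bounded periodic test of small period (card
`peel-and-fool-crr`, first lemma `periodicRung`): for `A > 0` and any real `B` there is `C` with

  `|Σ_{N < 2ⁿ} λ(N) G(N mod q)| ≤ C q 2ⁿ / n^B`

for all `n ≥ 2`, `1 ≤ q ≤ n^A` and every `1`-bounded `G : ℕ → ℝ` (real powers `n^A`, `n^B`).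

Proof: the tree's PROVED Siegel–Walfisz theorem for `λ` in arithmetic progressions,
`Literature.NumberTheory.LFunctions.SiegelWalfiszMoebius.liouville_progression` applied to
`Literature.NumberTheory.LFunctions.SiegelWalfiszMoebius_holds`, with exponents `2A` and
`2·max B 0`, at `x = 2ⁿ - 1` (`⌊x⌋₊ = 2ⁿ - 1`, the term `N = 0` vanishes since `λ 0 = 0`), summed
over the `q` residue classes (`Finset.sum_fiberwise` with `N ↦ (N : ZMod q)`, and
`N % q = (N : ZMod q).val`).  The range condition `q ≤ (log x)^{2A}` and the saving
`(log x)^{2 max B 0} ≥ n^{max B 0} ≥ n^B` both follow from `n ≤ (log x)²`, valid for `n ≥ 6` since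
`log x ≥ (n-1) log 2 ≥ (n-1)/2`; the finitely many `2 ≤ n < 6` are absorbed by the trivial bound
`|Σ| ≤ 2ⁿ` and the constant `6^{max B 0}`.
-/

set_option linter.dupNamespace false -- D-0017: single-problem summit ⇒ `QuantumAdvantage.QuantumAdvantage` by design

noncomputable section

namespace Summit.QuantumAdvantage.QuantumAdvantage.Theorems.LiouvilleOrthogonalTC0

open Finset
open Literature.NumberTheory.LFunctions

namespace StubPeriodic

/-- The trivial bound `|Σ_{N < 2ⁿ} λ(N) G(N mod q)| ≤ 2ⁿ` for `1`-bounded `G`. -/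
theorem abs_sum_liouville_mul_le (n q : ℕ) {G : ℕ → ℝ} (hG : ∀ a, |G a| ≤ 1) :
    |∑ N ∈ range (2 ^ n), ((ArithmeticFunction.liouville N : ℤ) : ℝ) * G (N % q)| ≤ 2 ^ n := by
  refine (abs_sum_le_sum_abs _ _).trans ?_
  have h : ∀ N ∈ range (2 ^ n),
      |((ArithmeticFunction.liouville N : ℤ) : ℝ) * G (N % q)| ≤ (1 : ℝ) := by
    intro N _
    rw [abs_mul]
    exact (mul_le_mul (LiouvilleSum.abs_liouville_le_one N) (hG (N % q)) (abs_nonneg _)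
      zero_le_one).trans_eq (one_mul 1)
  refine (sum_le_sum h).trans ?_
  simp

/-- Decomposition into residue classes: for `q ≥ 1`,
`Σ_{N < 2ⁿ} λ(N) G(N mod q) = Σ_{a mod q} G(a) Σ_{1 ≤ N ≤ 2ⁿ - 1, N ≡ a (q)} λ(N)`
(the term `N = 0` vanishes as `λ 0 = 0`). -/
theorem sum_range_eq_sum_residues (n q : ℕ) [NeZero q] (G : ℕ → ℝ) :
    ∑ N ∈ range (2 ^ n), ((ArithmeticFunction.liouville N : ℤ) : ℝ) * G (N % q) =
      ∑ a : ZMod q, G a.val *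
        ∑ N ∈ (Icc 1 (2 ^ n - 1)).filter (fun N : ℕ => (N : ZMod q) = a),
          ((ArithmeticFunction.liouville N : ℤ) : ℝ) := by
  have h1 : 1 ≤ 2 ^ n := Nat.one_le_two_pow
  have hsub : Icc 1 (2 ^ n - 1) ⊆ range (2 ^ n) := by
    intro N hN
    rw [mem_Icc] at hN
    rw [mem_range]
    omega
  have hzero : ∀ N ∈ range (2 ^ n), N ∉ Icc 1 (2 ^ n - 1) →
      ((ArithmeticFunction.liouville N : ℤ) : ℝ) * G (N % q) = 0 := by
    intro N hN hN'
    rw [mem_range] at hN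
    rw [mem_Icc] at hN'
    have h0 : N = 0 := by omega
    subst h0
    simp
  rw [← sum_subset hsub hzero, ← Finset.sum_fiberwise (Icc 1 (2 ^ n - 1)) (fun N : ℕ => (N : ZMod q))
    (fun N : ℕ => ((ArithmeticFunction.liouville N : ℤ) : ℝ) * G (N % q))]
  refine sum_congr rfl fun a _ => ?_
  rw [mul_sum]
  refine sum_congr rfl fun N hN => ?_
  obtain ⟨-, hNa⟩ := mem_filter.1 hN
  rw [← hNa, ZMod.val_natCast, mul_comm]

/-- `log 2 > 1/2`. -/
theorem half_lt_log_two : (1 / 2 : ℝ) < Real.log 2 :=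
  lt_trans (by norm_num) Real.log_two_gt_d9

/-- For `n ≥ 6` and `x = 2ⁿ - 1`: `n ≤ (log x)²` (from `log x ≥ (n - 1) log 2 ≥ (n - 1)/2`). -/
theorem natCast_le_log_sq {n : ℕ} (hn : 6 ≤ n) {x : ℝ} (hx : x = 2 ^ n - 1) :
    (n : ℝ) ≤ Real.log x ^ 2 := by
  have hn6 : (6 : ℝ) ≤ n := by exact_mod_cast hn
  have h2n : (4 : ℝ) ≤ (2 : ℝ) ^ n :=
    calc (4 : ℝ) = 2 ^ 2 := by norm_num
      _ ≤ 2 ^ n := pow_le_pow_right₀ (by norm_num) (by omega)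
  have hhalf : (2 : ℝ) ^ n / 2 ≤ x := by rw [hx]; linarith
  have hlog : Real.log ((2 : ℝ) ^ n / 2) = ((n : ℝ) - 1) * Real.log 2 := by
    rw [Real.log_div (by positivity) (by norm_num), Real.log_pow]
    ring
  have hL : ((n : ℝ) - 1) / 2 ≤ Real.log x := by
    have h1 : Real.log ((2 : ℝ) ^ n / 2) ≤ Real.log x := Real.log_le_log (by positivity) hhalf
    rw [hlog] at h1
    have h3 : ((n : ℝ) - 1) * (1 / 2) ≤ ((n : ℝ) - 1) * Real.log 2 :=
      mul_le_mul_of_nonneg_left half_lt_log_two.le (by linarith)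
    linarith
  have h1 : (n : ℝ) ≤ (((n : ℝ) - 1) / 2) ^ 2 := by
    nlinarith [mul_nonneg (sub_nonneg.mpr hn6) (by linarith : (0 : ℝ) ≤ n)]
  exact h1.trans (pow_le_pow_left₀ (by linarith) hL 2)

end StubPeriodic

open StubPeriodic in
/-- **Stub `stub_periodic` (`λ` is orthogonal to periodic tests of small period; card
`peel-and-fool-crr`'s first lemma `periodicRung`).** For `A > 0` and any `B` there is `C` with
`|Σ_{N<2ⁿ} λ(N) G(N mod q)| ≤ C q 2ⁿ / n^B` for all `n ≥ 2`, `1 ≤ q ≤ n^A` and `1`-bounded `G`; from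
the tree's PROVED Siegel–Walfisz theorem for `λ` in progressions,
`Literature.NumberTheory.LFunctions.SiegelWalfiszMoebius.liouville_progression` applied to
`SiegelWalfiszMoebius_holds` (with `x = 2ⁿ - 1`, exponents `2A`, `2 max B 0`, and the `q` residue
classes). -/
theorem stub_periodic (A : ℝ) (hA : 0 < A) (B : ℝ) :
    ∃ C : ℝ, ∀ n : ℕ, 2 ≤ n → ∀ q : ℕ, 1 ≤ q → (q : ℝ) ≤ (n : ℝ) ^ A →
      ∀ G : ℕ → ℝ, (∀ a, |G a| ≤ 1) →
        |∑ N ∈ range (2 ^ n), ((ArithmeticFunction.liouville N : ℤ) : ℝ) * G (N % q)| ≤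
          C * q * 2 ^ n / (n : ℝ) ^ B := by
  obtain ⟨C₁, hC₁⟩ :=
    SiegelWalfiszMoebius_holds.liouville_progression (A := 2 * A) (by positivity) (2 * max B 0)
  have hB'0 : 0 ≤ max B 0 := le_max_right _ _
  have hC₀0 : 0 ≤ max C₁ 0 := le_max_right _ _
  have hCs0 : 0 ≤ (6 : ℝ) ^ max B 0 := Real.rpow_nonneg (by norm_num) _
  refine ⟨max (max C₁ 0) ((6 : ℝ) ^ max B 0), fun n hn q hq hqA G hG => ?_⟩
  have hK0 : 0 ≤ max (max C₁ 0) ((6 : ℝ) ^ max B 0) := hC₀0.trans (le_max_left _ _)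
  have hn0 : (0 : ℝ) < n := by exact_mod_cast (by omega : 0 < n)
  have hn1 : (1 : ℝ) ≤ n := by exact_mod_cast (by omega : 1 ≤ n)
  have hq1 : (1 : ℝ) ≤ q := by exact_mod_cast hq
  have hq0 : (0 : ℝ) < q := by linarith
  have hP : 0 < (n : ℝ) ^ B := Real.rpow_pos_of_pos hn0 B
  have hPP' : (n : ℝ) ^ B ≤ (n : ℝ) ^ max B 0 :=
    Real.rpow_le_rpow_of_exponent_le hn1 (le_max_left _ _)
  rcases lt_or_ge n 6 with hn6 | hn6
  · -- small `n`: the trivial bound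
    refine (abs_sum_liouville_mul_le n q hG).trans ?_
    rw [le_div_iff₀ hP]
    have hn6' : (n : ℝ) ≤ 6 := by exact_mod_cast hn6.le
    have h1 : (n : ℝ) ^ B ≤ (6 : ℝ) ^ max B 0 :=
      hPP'.trans (Real.rpow_le_rpow hn0.le hn6' hB'0)
    have h2 : (n : ℝ) ^ B ≤ max (max C₁ 0) ((6 : ℝ) ^ max B 0) * q :=
      calc (n : ℝ) ^ B ≤ (6 : ℝ) ^ max B 0 * 1 := by rw [mul_one]; exact h1
        _ ≤ max (max C₁ 0) ((6 : ℝ) ^ max B 0) * q :=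
          mul_le_mul (le_max_right _ _) hq1 zero_le_one hK0
    calc (2 : ℝ) ^ n * (n : ℝ) ^ B ≤ 2 ^ n * (max (max C₁ 0) ((6 : ℝ) ^ max B 0) * q) :=
          mul_le_mul_of_nonneg_left h2 (by positivity)
      _ = max (max C₁ 0) ((6 : ℝ) ^ max B 0) * q * 2 ^ n := by ring
  · -- large `n`: Siegel–Walfisz on each residue class, `x = 2ⁿ - 1`
    haveI : NeZero q := ⟨by omega⟩
    obtain ⟨x, hx⟩ : ∃ x : ℝ, x = 2 ^ n - 1 := ⟨_, rfl⟩
    have h2n : (4 : ℝ) ≤ (2 : ℝ) ^ n :=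
      calc (4 : ℝ) = 2 ^ 2 := by norm_num
        _ ≤ 2 ^ n := pow_le_pow_right₀ (by norm_num) (by omega)
    have hx2 : 2 ≤ x := by rw [hx]; linarith
    have hx0 : 0 < x := by linarith
    have hxle : x ≤ 2 ^ n := by rw [hx]; linarith
    have hfloor : ⌊x⌋₊ = 2 ^ n - 1 := by
      have : x = ((2 ^ n - 1 : ℕ) : ℝ) := by
        rw [hx, Nat.cast_sub Nat.one_le_two_pow, Nat.cast_pow, Nat.cast_ofNat, Nat.cast_one]
      rw [this, Nat.floor_natCast]
    have hL0 : 0 < Real.log x := Real.log_pos (by linarith)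
    have hnL : (n : ℝ) ≤ Real.log x ^ 2 := natCast_le_log_sq hn6 hx
    -- the range condition `q ≤ (log x)^{2A}`
    have hqA' : (q : ℝ) ≤ Real.log x ^ (2 * A) :=
      calc (q : ℝ) ≤ (n : ℝ) ^ A := hqA
        _ ≤ (Real.log x ^ 2) ^ A := Real.rpow_le_rpow hn0.le hnL hA.le
        _ = Real.log x ^ (2 * A) := by rw [Real.rpow_mul hL0.le, Real.rpow_two]
    -- the saving `n^{max B 0} ≤ (log x)^{2 max B 0}`
    have hsav : (n : ℝ) ^ max B 0 ≤ Real.log x ^ (2 * max B 0) :=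
      calc (n : ℝ) ^ max B 0 ≤ (Real.log x ^ 2) ^ max B 0 := Real.rpow_le_rpow hn0.le hnL hB'0
        _ = Real.log x ^ (2 * max B 0) := by rw [Real.rpow_mul hL0.le, Real.rpow_two]
    have hpow : 0 < Real.log x ^ (2 * max B 0) := Real.rpow_pos_of_pos hL0 _
    -- each residue class
    have key : ∀ a : ZMod q,
        |G a.val * ∑ N ∈ (Icc 1 (2 ^ n - 1)).filter (fun N : ℕ => (N : ZMod q) = a),
          ((ArithmeticFunction.liouville N : ℤ) : ℝ)| ≤
          max C₁ 0 * x / Real.log x ^ (2 * max B 0) := by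
      intro a
      have h := hC₁ x hx2 q hq hqA' a
      rw [hfloor] at h
      have h' : |∑ N ∈ (Icc 1 (2 ^ n - 1)).filter (fun N : ℕ => (N : ZMod q) = a),
          ((ArithmeticFunction.liouville N : ℤ) : ℝ)| ≤
          max C₁ 0 * x / Real.log x ^ (2 * max B 0) := by
        refine h.trans ?_
        rw [div_le_div_iff_of_pos_right hpow]
        exact mul_le_mul_of_nonneg_right (le_max_left _ _) hx0.le
      rw [abs_mul]
      exact (mul_le_mul (hG _) h' (abs_nonneg _) zero_le_one).trans_eq (one_mul _)
    rw [sum_range_eq_sum_residues n q G]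
    refine (abs_sum_le_sum_abs _ _).trans ?_
    refine (sum_le_sum fun a _ => key a).trans ?_
    rw [sum_const, card_univ, ZMod.card q, nsmul_eq_mul]
    calc (q : ℝ) * (max C₁ 0 * x / Real.log x ^ (2 * max B 0))
        ≤ q * (max C₁ 0 * 2 ^ n / (n : ℝ) ^ B) := by
          refine mul_le_mul_of_nonneg_left ?_ hq0.le
          calc max C₁ 0 * x / Real.log x ^ (2 * max B 0)
              ≤ max C₁ 0 * 2 ^ n / Real.log x ^ (2 * max B 0) :=
                div_le_div_of_nonneg_right (mul_le_mul_of_nonneg_left hxle hC₀0) hpow.le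
            _ ≤ max C₁ 0 * 2 ^ n / (n : ℝ) ^ B :=
                div_le_div_of_nonneg_left (by positivity) hP (hPP'.trans hsav)
      _ = max C₁ 0 * q * 2 ^ n / (n : ℝ) ^ B := by ring
      _ ≤ max (max C₁ 0) ((6 : ℝ) ^ max B 0) * q * 2 ^ n / (n : ℝ) ^ B := by
          refine div_le_div_of_nonneg_right ?_ hP.le
          exact mul_le_mul_of_nonneg_right
            (mul_le_mul_of_nonneg_right (le_max_left _ _) hq0.le) (by positivity)

end Summit.QuantumAdvantage.QuantumAdvantage.Theorems.LiouvilleOrthogonalTC0
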